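/-
Copyright: public-domain mathematics; typed transcription for the H21 Literature library (cell lit-balaban,
reader/typer seat r02 gen 5 = literature-prover-lit-balaban-r02-g5-0).

statement-level skeleton of published theorems with citation tags; proofs where landed; nothing here is a claim about the Yang–Mills mass gap

# Bałaban, *Propagators and renormalization transformations for lattice gauge theories. I*,
# Commun. Math. Phys. **95** (1984) 17–40 — the operator dictionary, part 2: `G₀` itself, the gradients and divergences,
# the `L²(T_η)` norms and the quadratic forms of (1.89)/(1.90) through the site bridge

[cite: Balaban1984PropagatorsI]  T. Bałaban, Commun. Math. Phys. 95 (1984) 17–40.  p. 33 Prop. 1.1 (1.89)–(1.90) (PDF p. 17); p. 39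
(1.132)–(1.134) (PDF p. 23): `G₀ = (Δ + aQ*Q)^{−1}`, «Proposition 1.1 for G₀»; p. 21 (1.21): the weight `η^d`.

WHAT THIS MODULE ADDS (SKELETON rows B5.Prop1.2 census (iv), B5.Eq1.134; sequel of `B5G0BridgeP12`).  With `embA` of part 1:
* `G0_embA`: **`G₀` agrees** — `B5Prop11G0Torus.G0 n M a *ᵥ embA A = embA (μ ↦ B5Eq133G0Torus.G0 P a 0 K μ · A_μ)` (`a > 0`);
* `grad_embA`, `grad2_embA`, `divT_embA`, `divT2_embA`: the gradients (1.89) `∇G₀J`, `∇∇G₀J` and divergences `∇*J`, `∇*∇*J` agree;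
* `nsq_embA`, `l2_embA_sq`, `l2T_embA_sq`, **`l2NormV_eq`**: `Σ‖embA A‖² = Σ_μΣ_x A_μ(x)²` and p37's weighted norm
  `l2NormV P K A = η^{d/2}·l2 (embA A)` (`η^{d/2} = B5SettingP12Weighted.sqEta n d`);
* `dot_embA`, `form_G0inv_embA`, `embA_LapOne`, `form_LapOne_embA`: the two quadratic forms of (1.90) for `G₀`
  (`Re⟨A, (Δ + aQ*Q)A⟩`, `Re⟨A, (Δ + 1)A⟩`) agree with `Σ_μ ⟨A_μ, M0·A_μ⟩`, `Σ_μ ⟨A_μ, hOp P 0 ε 1·A_μ⟩`.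
* §7 **«PROPOSITION 1.1 FOR G₀» IN THE TOWER TYPING** (transport of p251794 `B5Prop11G0Torus.l2opG0_le` / `ineq190_G0_form`):
  with the tower shorthands `tG0 a A = (G₀^{(μ)}A_μ)_μ`, `tD ν`, `tDiv`, `tDiv2`, `tl2`, `tl2T`, the six bounds (1.89)
  `towerG0_ineq189_0 … _5` — `‖G₀J‖, ‖∇G₀J‖, ‖G₀∇*J‖, ‖∇G₀∇*J‖, ‖∇∇G₀J‖, ‖G₀∇*∇*J‖ ≤ γ₀(G₀)^{−1}‖J‖` with p251794's constant
  `gammaG0 d a` (unweighted sums on both sides; the printed weight `η^{d/2}` cancels) — and (1.90) `towerG0_ineq190`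
  `γ₀(G₀)·Σ_μ⟨A_μ,(−Δ^ε+1)A_μ⟩ ≤ Σ_μ⟨A_μ,(Δ+aQ*Q)^{(μ)}A_μ⟩`; `gammaG0_pos'`.
So «Prop. 1.1 for G₀» holds for p37's operators with the same constant; a tower `B5.Setting` for G₀ gets `B5.Prop11Printed` by
pointing its `l2op`/`formΔa`/`formΔI` fields at these expressions.

HONEST SCOPE.  Bookkeeping identities; nothing analytic.
-/
import Mathlib
import Literature.MathematicalPhysics.QuantumFieldTheory.Balaban1983to89.B5G0BridgeP12
import Literature.MathematicalPhysics.QuantumFieldTheory.Balaban1983to89.B5SettingP12Weighted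

open scoped BigOperators Matrix Real ComplexConjugate
open Finset Matrix

namespace Literature.MathematicalPhysics.QuantumFieldTheory.Balaban1983to89.B5G0BridgeP12

open Literature.MathematicalPhysics.QuantumFieldTheory.Balaban1983to89
open Literature.MathematicalPhysics.QuantumFieldTheory.Balaban1983to89.B5Prop11Plancherel (Tor fine fdiff)
open Literature.MathematicalPhysics.QuantumFieldTheory.Balaban1983to89.B5Prop11Lower (Lap nsq nsq_nonneg)
open Literature.MathematicalPhysics.QuantumFieldTheory.Balaban1983to89.B5Prop11Lattice (l2 l2T grad grad2 divT divT2)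
open Literature.MathematicalPhysics.QuantumFieldTheory.Balaban1983to89.B5SiteBridgeP12 (nP MP eFine eFine_val one_le_nP)
open Literature.MathematicalPhysics.QuantumFieldTheory.Balaban1983to89.B5Prop11G0Torus (G0inv G0_mul_G0inv)
open Literature.MathematicalPhysics.QuantumFieldTheory.Balaban1983to89.B5Eq133G0Torus (M0 M0_mul_G0)
open Literature.MathematicalPhysics.QuantumFieldTheory.Balaban1983to89.B5GpSettingTorus (l2NormV)
open Literature.MathematicalPhysics.QuantumFieldTheory.Balaban1983to89.B5SettingP12Weighted (etaPow sqEta etaPow_nonneg)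
open Literature.MathematicalPhysics.QuantumFieldTheory.Balaban1983to89.B1RG242Torus (deriv hOp hOp_mulVec)

noncomputable section

variable (P : Params)

/-! ## §4 `G₀` agrees -/

/-- **`G₀ = (Δ + aQ*Q)^{−1}` agrees in the two typings** (`a > 0`). [cite: Balaban1984PropagatorsI, (1.132) p.39] -/
theorem G0_embA {a : ℝ} (ha : 0 < a) (A : Fin P.d → Site P 0 → ℝ) :
    B5Prop11G0Torus.G0 (nP P) (MP P) a *ᵥ embA P A
      = embA P (fun μ => B5Eq133G0Torus.G0 P a 0 P.K μ *ᵥ A μ) := by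
  set B : Fin P.d → Site P 0 → ℝ := fun μ => B5Eq133G0Torus.G0 P a 0 P.K μ *ᵥ A μ with hB
  have h1 : G0inv (nP P) (MP P) a *ᵥ embA P B = embA P A := by
    rw [G0inv_embA]
    congr 1
    funext μ
    rw [hB, Matrix.mulVec_mulVec, M0_mul_G0 ha le_rfl (Nat.le_add_left P.K P.m), Matrix.one_mulVec]
  rw [← h1, Matrix.mulVec_mulVec, G0_mul_G0inv (nP P) (one_le_nP P) (MP P) a ha, Matrix.one_mulVec]

/-! ## §5 Gradients and divergences agree -/

/-- `∇(embA A)_ν = embA (∂_ν A)`. [cite: Balaban1984PropagatorsI, Prop. 1.1 (1.89) p.33] -/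
theorem grad_embA (A : Fin P.d → Site P 0 → ℝ) (ν : Fin P.d) :
    grad (nP P) (MP P) (embA P A) ν = embA P (fun μ => deriv P 0 P.eps ν *ᵥ A μ) :=
  embA_deriv P A ν

/-- `∇∇(embA A)_{νν′} = embA (∂_ν∂_{ν′} A)`. [cite: Balaban1984PropagatorsI, Prop. 1.1 (1.89) p.33] -/
theorem grad2_embA (A : Fin P.d → Site P 0 → ℝ) (p : Fin P.d × Fin P.d) :
    grad2 (nP P) (MP P) (embA P A) p = embA P (fun μ => deriv P 0 P.eps p.1 *ᵥ (deriv P 0 P.eps p.2 *ᵥ A μ)) := by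
  show fdiff (fine (nP P) (MP P)) (nP P : ℂ) p.1 *ᵥ (fdiff (fine (nP P) (MP P)) (nP P : ℂ) p.2 *ᵥ embA P A) = _
  rw [embA_deriv, embA_deriv]

/-- `∇*(embA ∘ T) = embA (Σ_ν ∂ᵀ_ν T_ν)`. [cite: Balaban1984PropagatorsI, Prop. 1.1 (1.89) p.33] -/
theorem divT_embA (T : Fin P.d → Fin P.d → Site P 0 → ℝ) :
    divT (nP P) (MP P) (fun ν => embA P (T ν)) = embA P (∑ ν, fun μ => (deriv P 0 P.eps ν)ᵀ *ᵥ T ν μ) := by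
  rw [embA_sum]
  show ∑ ν, star (fdiff (fine (nP P) (MP P)) (nP P : ℂ) ν) *ᵥ embA P (T ν) = _
  refine Finset.sum_congr rfl fun ν _ => ?_
  rw [Matrix.star_eq_conjTranspose, embA_derivT]

/-- `∇*∇*(embA ∘ T) = embA (Σ_{ν,ν′} ∂ᵀ_ν∂ᵀ_{ν′} T_{νν′})`. [cite: Balaban1984PropagatorsI, Prop. 1.1 (1.89) p.33] -/
theorem divT2_embA (T : Fin P.d × Fin P.d → Fin P.d → Site P 0 → ℝ) :
    divT2 (nP P) (MP P) (fun p => embA P (T p))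
      = embA P (∑ p, fun μ => (deriv P 0 P.eps p.1)ᵀ *ᵥ ((deriv P 0 P.eps p.2)ᵀ *ᵥ T p μ)) := by
  rw [embA_sum]
  show ∑ p, star (fdiff (fine (nP P) (MP P)) (nP P : ℂ) p.1) *ᵥ
      (star (fdiff (fine (nP P) (MP P)) (nP P : ℂ) p.2) *ᵥ embA P (T p)) = _
  refine Finset.sum_congr rfl fun p _ => ?_
  rw [Matrix.star_eq_conjTranspose, Matrix.star_eq_conjTranspose, embA_derivT, embA_derivT]

/-! ## §6 Norms and forms agree -/

/-- **`Σ_b ‖embA A (b)‖² = Σ_μ Σ_x A_μ(x)²`.** [cite: Balaban1984PropagatorsI, Prop. 1.1 (1.89) p.33, (1.21) p.21] -/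
theorem nsq_embA (A : Fin P.d → Site P 0 → ℝ) : nsq (embA P A) = ∑ μ, ∑ x, A μ x ^ 2 := by
  classical
  unfold nsq
  rw [← ((eFine P).prodCongr (Equiv.refl (Fin P.d))).sum_comp]
  simp only [Equiv.prodCongr_apply, Equiv.coe_refl]
  rw [Fintype.sum_prod_type, Finset.sum_comm]
  refine Finset.sum_congr rfl fun μ _ => Finset.sum_congr rfl fun x _ => ?_
  simp only [Prod.map_apply, id_eq, embA_apply, Equiv.symm_apply_apply, Complex.norm_real, Real.norm_eq_abs, sq_abs]

/-- `l2 (embA A)² = Σ_μ Σ_x A_μ(x)²`. [cite: Balaban1984PropagatorsI, Prop. 1.1 (1.89) p.33] -/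
theorem l2_embA_sq (A : Fin P.d → Site P 0 → ℝ) : l2 (embA P A) ^ 2 = ∑ μ, ∑ x, A μ x ^ 2 := by
  rw [B5Prop11Lattice.l2_sq, nsq_embA]

/-- `l2T (embA ∘ F)² = Σ_s Σ_μ Σ_x F_s,μ(x)²` (tensor fields). [cite: Balaban1984PropagatorsI, Prop. 1.1 (1.89) p.33] -/
theorem l2T_embA_sq {S : Type*} [Fintype S] (F : S → Fin P.d → Site P 0 → ℝ) :
    l2T (fun s => embA P (F s)) ^ 2 = ∑ s, ∑ μ, ∑ x, F s μ x ^ 2 := by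
  rw [B5Prop11Lattice.l2T_sq]
  exact Finset.sum_congr rfl fun s _ => nsq_embA P (F s)

/-- `(L^K)^{−d} = η^d` as reals (`η = 1/n`). [cite: Balaban1984PropagatorsI, (1.21) p.21] -/
theorem Lpow_inv_pow_d : (((P.L : ℝ) ^ P.K)⁻¹) ^ P.d = etaPow (nP P) P.d := by
  rw [Lpow_K_eq, etaPow]

/-- **p37's weighted norm is `η^{d/2}` times the `ℓ²` norm of the embedded field**: `l2NormV P K A = sqEta n d · l2 (embA A)`.
[cite: Balaban1984PropagatorsI, (1.21) p.21, Prop. 1.1 (1.89) p.33] -/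
theorem l2NormV_eq (A : Fin P.d → Site P 0 → ℝ) : l2NormV P P.K A = sqEta (nP P) P.d * l2 (embA P A) := by
  rw [l2NormV, sqEta, l2, ← Real.sqrt_mul (etaPow_nonneg _ _), nsq_embA, Finset.mul_sum]
  congr 1
  refine Finset.sum_congr rfl fun ν _ => ?_
  rw [Finset.mul_sum]
  refine Finset.sum_congr rfl fun x _ => ?_
  rw [Lpow_inv_pow_d]

/-- **inner products agree**: `⟨embA A, embA B⟩ = Σ_μ ⟨A_μ, B_μ⟩`. [cite: Balaban1984PropagatorsI, (1.21) p.21] -/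
theorem dot_embA (A B : Fin P.d → Site P 0 → ℝ) :
    star (embA P A) ⬝ᵥ embA P B = ((∑ μ, A μ ⬝ᵥ B μ : ℝ) : ℂ) := by
  classical
  simp only [dotProduct]
  rw [← ((eFine P).prodCongr (Equiv.refl (Fin P.d))).sum_comp]
  simp only [Equiv.prodCongr_apply, Equiv.coe_refl]
  rw [Fintype.sum_prod_type, Finset.sum_comm]
  push_cast
  refine Finset.sum_congr rfl fun μ _ => Finset.sum_congr rfl fun x _ => ?_
  simp only [Prod.map_apply, id_eq, Pi.star_apply, embA_apply, Equiv.symm_apply_apply, Complex.star_def,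
    Complex.conj_ofReal]

/-- **the form `⟨A, (Δ + aQ*Q)A⟩` of (1.90) for `G₀` agrees**: `Re⟨embA A, G0inv·embA A⟩ = Σ_μ ⟨A_μ, M0·A_μ⟩`.
[cite: Balaban1984PropagatorsI, Prop. 1.1 (1.90) p.33, (1.132) p.39] -/
theorem form_G0inv_embA (a : ℝ) (A : Fin P.d → Site P 0 → ℝ) :
    (star (embA P A) ⬝ᵥ (G0inv (nP P) (MP P) a *ᵥ embA P A)).re = ∑ μ, A μ ⬝ᵥ (M0 P a 0 P.K μ *ᵥ A μ) := by
  rw [G0inv_embA, dot_embA, Complex.ofReal_re]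

/-- **`Δ + 1` agrees**: `(Lap + 1)(embA A) = embA ((−Δ^ε + 1)A)` (`hOp P 0 ε 1`). [cite: Balaban1984PropagatorsI, Prop. 1.1 (1.90) p.33] -/
theorem embA_LapOne (A : Fin P.d → Site P 0 → ℝ) :
    (Lap (nP P) (MP P) + 1) *ᵥ embA P A = embA P (fun μ => hOp P 0 P.eps 1 *ᵥ A μ) := by
  rw [Matrix.add_mulVec, Matrix.one_mulVec, embA_Lap]
  funext b
  obtain ⟨z, μ⟩ := b
  simp only [Pi.add_apply, embA_apply, hOp_mulVec, zero_smul, zero_add, one_smul, Finset.sum_apply]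
  push_cast
  ring

/-- **the form `⟨A, (Δ + I)A⟩` of (1.90) agrees**: `Re⟨embA A, (Lap + 1)·embA A⟩ = Σ_μ ⟨A_μ, hOp P 0 ε 1·A_μ⟩`.
[cite: Balaban1984PropagatorsI, Prop. 1.1 (1.90) p.33] -/
theorem form_LapOne_embA (A : Fin P.d → Site P 0 → ℝ) :
    (star (embA P A) ⬝ᵥ ((Lap (nP P) (MP P) + 1) *ᵥ embA P A)).re = ∑ μ, A μ ⬝ᵥ (hOp P 0 P.eps 1 *ᵥ A μ) := by
  rw [embA_LapOne, dot_embA, Complex.ofReal_re]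


/-! ## §7 «Proposition 1.1 for G₀» in the tower typing -/

section Tower

/-- `ℓ²` norm of a tower vector function (all components, all sites; unweighted). [cite: Balaban1984PropagatorsI, (1.89) p.33] -/
def tl2 (F : Fin P.d → Site P 0 → ℝ) : ℝ := Real.sqrt (∑ μ, ∑ x, F μ x ^ 2)

/-- `ℓ²` norm of a tower tensor function. [cite: Balaban1984PropagatorsI, (1.89) p.33] -/
def tl2T {S : Type*} [Fintype S] (F : S → Fin P.d → Site P 0 → ℝ) : ℝ := Real.sqrt (∑ s, ∑ μ, ∑ x, F s μ x ^ 2)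

/-- `G₀A := (G₀^{(μ)}A_μ)_μ` (p37's per-direction `G0` at the top level, `m² = 0`). [cite: Balaban1984PropagatorsI, (1.132) p.39] -/
def tG0 (a : ℝ) (A : Fin P.d → Site P 0 → ℝ) : Fin P.d → Site P 0 → ℝ := fun μ => B5Eq133G0Torus.G0 P a 0 P.K μ *ᵥ A μ

/-- `∂_νA := (∂^ε_νA_μ)_μ`. [cite: Balaban1984PropagatorsI, (1.31) p.23] -/
def tD (ν : Fin P.d) (A : Fin P.d → Site P 0 → ℝ) : Fin P.d → Site P 0 → ℝ := fun μ => deriv P 0 P.eps ν *ᵥ A μ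

/-- `∇*T := (Σ_ν ∂ᵀ_ν T_{νμ})_μ`. [cite: Balaban1984PropagatorsI, (1.89) p.33] -/
def tDiv (T : Fin P.d → Fin P.d → Site P 0 → ℝ) : Fin P.d → Site P 0 → ℝ := ∑ ν, fun μ => (deriv P 0 P.eps ν)ᵀ *ᵥ T ν μ

/-- `∇*∇*T := (Σ_{ν,ν′} ∂ᵀ_ν∂ᵀ_{ν′} T_{νν′μ})_μ`. [cite: Balaban1984PropagatorsI, (1.89) p.33] -/
def tDiv2 (T : Fin P.d × Fin P.d → Fin P.d → Site P 0 → ℝ) : Fin P.d → Site P 0 → ℝ :=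
  ∑ p, fun μ => (deriv P 0 P.eps p.1)ᵀ *ᵥ ((deriv P 0 P.eps p.2)ᵀ *ᵥ T p μ)

/-- `l2 (embA A) = tl2 A`. [cite: Balaban1984PropagatorsI, (1.89) p.33] -/
theorem l2_embA (A : Fin P.d → Site P 0 → ℝ) : l2 (embA P A) = tl2 P A := by
  rw [l2, nsq_embA, tl2]

/-- `l2T (embA ∘ F) = tl2T F`. [cite: Balaban1984PropagatorsI, (1.89) p.33] -/
theorem l2T_embA {S : Type*} [Fintype S] (F : S → Fin P.d → Site P 0 → ℝ) : l2T (fun s => embA P (F s)) = tl2T P F := by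
  rw [l2T, tl2T]
  congr 1
  exact Finset.sum_congr rfl fun s _ => nsq_embA P (F s)

/-- `G₀·(embA A) = embA (G₀A)` with the shorthand. [cite: Balaban1984PropagatorsI, (1.132) p.39] -/
theorem G0_embA' {a : ℝ} (ha : 0 < a) (A : Fin P.d → Site P 0 → ℝ) :
    B5Prop11G0Torus.G0 (nP P) (MP P) a *ᵥ embA P A = embA P (tG0 P a A) :=
  G0_embA P ha A

/-- `embA (∂_ν B) = ∇(embA B)_ν`. [cite: Balaban1984PropagatorsI, (1.31) p.23] -/
theorem embA_tD (ν : Fin P.d) (B : Fin P.d → Site P 0 → ℝ) : embA P (tD P ν B) = grad (nP P) (MP P) (embA P B) ν :=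
  (grad_embA P B ν).symm

/-- `embA (∇*T) = ∇*(embA ∘ T)`. [cite: Balaban1984PropagatorsI, (1.89) p.33] -/
theorem embA_tDiv (T : Fin P.d → Fin P.d → Site P 0 → ℝ) : embA P (tDiv P T) = divT (nP P) (MP P) (fun ν => embA P (T ν)) :=
  (divT_embA P T).symm

/-- `embA (∇*∇*T) = ∇*∇*(embA ∘ T)`. [cite: Balaban1984PropagatorsI, (1.89) p.33] -/
theorem embA_tDiv2 (T : Fin P.d × Fin P.d → Fin P.d → Site P 0 → ℝ) :
    embA P (tDiv2 P T) = divT2 (nP P) (MP P) (fun p => embA P (T p)) :=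
  (divT2_embA P T).symm

variable {P}

/-- **`0 < γ₀(G₀)`** (p251794's constant; its positivity lemma there is private). [cite: Balaban1984PropagatorsI, Prop. 1.1 p.33] -/
theorem gammaG0_pos' {d : ℕ} {a : ℝ} (ha : 0 ≤ a) : 0 < B5Prop11G0Torus.gammaG0 d a := by
  unfold B5Prop11G0Torus.gammaG0 B5Prop11G0Torus.CstG0
  have hγ := inv_nonneg.mpr (B5Prop11Lattice.gammaZero_pos d a).le
  have : 0 < 1 + (1 + a) * (B5Prop11Lattice.gammaZero d a)⁻¹ := by positivity
  positivity

variable (P)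

/-- **(1.89) for `G₀`, tower typing, `‖G₀J‖ ≤ γ₀(G₀)^{−1}‖J‖`.** [cite: Balaban1984PropagatorsI, Prop. 1.1 (1.89) p.33, p.39] -/
theorem towerG0_ineq189_0 {a : ℝ} (ha : 0 < a) (A : Fin P.d → Site P 0 → ℝ) :
    tl2 P (tG0 P a A) ≤ (B5Prop11G0Torus.gammaG0 P.d a)⁻¹ * tl2 P A := by
  have h := B5Prop11G0Torus.l2opG0_le (n := nP P) (M := MP P) a ha 0 (.vec (embA P A))
  change l2 (B5Prop11G0Torus.G0 (nP P) (MP P) a *ᵥ embA P A) ≤ (B5Prop11G0Torus.gammaG0 P.d a)⁻¹ * l2 (embA P A) at h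
  rwa [G0_embA' P ha, l2_embA, l2_embA] at h

/-- **(1.89) for `G₀`, tower typing, `‖∇G₀J‖ ≤ γ₀(G₀)^{−1}‖J‖`.** [cite: Balaban1984PropagatorsI, Prop. 1.1 (1.89) p.33, p.39] -/
theorem towerG0_ineq189_1 {a : ℝ} (ha : 0 < a) (A : Fin P.d → Site P 0 → ℝ) :
    tl2T P (fun ν => tD P ν (tG0 P a A)) ≤ (B5Prop11G0Torus.gammaG0 P.d a)⁻¹ * tl2 P A := by
  have h := B5Prop11G0Torus.l2opG0_le (n := nP P) (M := MP P) a ha 1 (.vec (embA P A))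
  change l2T (grad (nP P) (MP P) (B5Prop11G0Torus.G0 (nP P) (MP P) a *ᵥ embA P A))
    ≤ (B5Prop11G0Torus.gammaG0 P.d a)⁻¹ * l2 (embA P A) at h
  have hg : grad (nP P) (MP P) (B5Prop11G0Torus.G0 (nP P) (MP P) a *ᵥ embA P A) = fun ν => embA P (tD P ν (tG0 P a A)) := by
    funext ν; rw [G0_embA' P ha, embA_tD]
  rwa [hg, l2T_embA, l2_embA] at h

/-- **(1.89) for `G₀`, tower typing, `‖G₀∇*J‖ ≤ γ₀(G₀)^{−1}‖J‖`** (tensor source `T_{νμ}`).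
[cite: Balaban1984PropagatorsI, Prop. 1.1 (1.89) p.33, p.39] -/
theorem towerG0_ineq189_2 {a : ℝ} (ha : 0 < a) (T : Fin P.d → Fin P.d → Site P 0 → ℝ) :
    tl2 P (tG0 P a (tDiv P T)) ≤ (B5Prop11G0Torus.gammaG0 P.d a)⁻¹ * tl2T P T := by
  have h := B5Prop11G0Torus.l2opG0_le (n := nP P) (M := MP P) a ha 2 (.ten fun ν => embA P (T ν))
  change l2 (B5Prop11G0Torus.G0 (nP P) (MP P) a *ᵥ divT (nP P) (MP P) (fun ν => embA P (T ν)))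
    ≤ (B5Prop11G0Torus.gammaG0 P.d a)⁻¹ * l2T (fun ν => embA P (T ν)) at h
  rwa [← embA_tDiv, G0_embA' P ha, l2_embA, l2T_embA] at h

/-- **(1.89) for `G₀`, tower typing, `‖∇G₀∇*J‖ ≤ γ₀(G₀)^{−1}‖J‖`.** [cite: Balaban1984PropagatorsI, Prop. 1.1 (1.89) p.33, p.39] -/
theorem towerG0_ineq189_3 {a : ℝ} (ha : 0 < a) (T : Fin P.d → Fin P.d → Site P 0 → ℝ) :
    tl2T P (fun ν => tD P ν (tG0 P a (tDiv P T))) ≤ (B5Prop11G0Torus.gammaG0 P.d a)⁻¹ * tl2T P T := by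
  have h := B5Prop11G0Torus.l2opG0_le (n := nP P) (M := MP P) a ha 3 (.ten fun ν => embA P (T ν))
  change l2T (grad (nP P) (MP P) (B5Prop11G0Torus.G0 (nP P) (MP P) a *ᵥ divT (nP P) (MP P) (fun ν => embA P (T ν))))
    ≤ (B5Prop11G0Torus.gammaG0 P.d a)⁻¹ * l2T (fun ν => embA P (T ν)) at h
  have hg : grad (nP P) (MP P) (B5Prop11G0Torus.G0 (nP P) (MP P) a *ᵥ divT (nP P) (MP P) (fun ν => embA P (T ν)))
      = fun ν => embA P (tD P ν (tG0 P a (tDiv P T))) := by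
    funext ν; rw [← embA_tDiv, G0_embA' P ha, embA_tD]
  rwa [hg, l2T_embA, l2T_embA] at h

/-- **(1.89) for `G₀`, tower typing, `‖∇∇G₀J‖ ≤ γ₀(G₀)^{−1}‖J‖`.** [cite: Balaban1984PropagatorsI, Prop. 1.1 (1.89) p.33, p.39] -/
theorem towerG0_ineq189_4 {a : ℝ} (ha : 0 < a) (A : Fin P.d → Site P 0 → ℝ) :
    tl2T P (fun p : Fin P.d × Fin P.d => tD P p.1 (tD P p.2 (tG0 P a A))) ≤ (B5Prop11G0Torus.gammaG0 P.d a)⁻¹ * tl2 P A := by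
  have h := B5Prop11G0Torus.l2opG0_le (n := nP P) (M := MP P) a ha 4 (.vec (embA P A))
  change l2T (grad2 (nP P) (MP P) (B5Prop11G0Torus.G0 (nP P) (MP P) a *ᵥ embA P A))
    ≤ (B5Prop11G0Torus.gammaG0 P.d a)⁻¹ * l2 (embA P A) at h
  have hg : grad2 (nP P) (MP P) (B5Prop11G0Torus.G0 (nP P) (MP P) a *ᵥ embA P A)
      = fun p : Fin P.d × Fin P.d => embA P (tD P p.1 (tD P p.2 (tG0 P a A))) := by
    funext p; rw [G0_embA' P ha, grad2_embA]; rfl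
  rwa [hg, l2T_embA, l2_embA] at h

/-- **(1.89) for `G₀`, tower typing, `‖G₀∇*∇*J‖ ≤ γ₀(G₀)^{−1}‖J‖`** (3-tensor source).
[cite: Balaban1984PropagatorsI, Prop. 1.1 (1.89) p.33, p.39] -/
theorem towerG0_ineq189_5 {a : ℝ} (ha : 0 < a) (T : Fin P.d × Fin P.d → Fin P.d → Site P 0 → ℝ) :
    tl2 P (tG0 P a (tDiv2 P T)) ≤ (B5Prop11G0Torus.gammaG0 P.d a)⁻¹ * tl2T P T := by
  have h := B5Prop11G0Torus.l2opG0_le (n := nP P) (M := MP P) a ha 5 (.ten2 fun p => embA P (T p))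
  change l2 (B5Prop11G0Torus.G0 (nP P) (MP P) a *ᵥ divT2 (nP P) (MP P) (fun p => embA P (T p)))
    ≤ (B5Prop11G0Torus.gammaG0 P.d a)⁻¹ * l2T (fun p => embA P (T p)) at h
  rwa [← embA_tDiv2, G0_embA' P ha, l2_embA, l2T_embA] at h

/-- **(1.90) for `G₀`, tower typing: `γ₀(G₀)·Σ_μ⟨A_μ, (−Δ^ε + 1)A_μ⟩ ≤ Σ_μ⟨A_μ, (Δ + aQ*Q)^{(μ)}A_μ⟩`.**
[cite: Balaban1984PropagatorsI, Prop. 1.1 (1.90) p.33, p.39] -/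
theorem towerG0_ineq190 {a : ℝ} (ha : 0 < a) (A : Fin P.d → Site P 0 → ℝ) :
    B5Prop11G0Torus.gammaG0 P.d a * ∑ μ, A μ ⬝ᵥ (hOp P 0 P.eps 1 *ᵥ A μ) ≤ ∑ μ, A μ ⬝ᵥ (M0 P a 0 P.K μ *ᵥ A μ) := by
  have h := B5Prop11G0Torus.ineq190_G0_form (nP P) (one_le_nP P) (MP P) a ha (embA P A)
  rwa [form_LapOne_embA, form_G0inv_embA] at h

end Tower

end

end Literature.MathematicalPhysics.QuantumFieldTheory.Balaban1983to89.B5G0BridgeP12
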